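import Mathlib
import HarnessLib

/-!
# Fouvry–Tenenbaum 2021, Theorem 1.8, for the tilts `n ↦ z^{ω(n)}`, `|z| ≤ 1`

Topic `Literature/NumberTheory/Sieve`; namespace `Literature.NumberTheory.Sieve`.

É. Fouvry, G. Tenenbaum, *Multiplicative functions in large arithmetic progressions and
applications*, Trans. Amer. Math. Soc. 375 (2021/22), 245–299, doi:10.1090/tran/8442
[FouvryTenenbaum2021].  ONE NAMED FACT (D-0014: `def … : Prop`, users take `(h : …)`): the paper's
Bombieri–Vinogradov-type Theorem 1.8 (PDF p. 9, §1.4, "which may be seen as a variant of a result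
of Wolke [28, Satz 1]"), SPECIALISED to the one-parameter family of multiplicative functions
`f_z(n) = z^{ω(n)}`, `z` real with `|z| ≤ 1` (`ω = ArithmeticFunction.cardDistinctFactors`).

The printed theorem is UNIFORM over `D ≥ 1` and `f ∈ 𝓕(D, K)` (Definition 1.1, PDF p. 6:
multiplicative `f` with (i) a block sequence `2 = Υ₁ < Υ₂ < ⋯`, `Υ_{n+1}/Υ_n ≥ 1 + (log 2Υ_n)^{−K}`,
(ii) `f(p) = f(p')` for primes `Υ_n < p, p' ≤ Υ_{n+1}`, `p ≡ p' (mod D)`, (iii) `|f(n)| ≤ τ_K(n)`), with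
the bound `C D^{C₀} x/ℒ^A`, `ℒ := log 3x` (Conventions §1.1, PDF p. 5).  The source itself lists the
family vendored here as the model example: "Typical examples of elements of `𝓕(1, K)` for some `K`
are provided by the functions `n ↦ z^{ω(n)}` and `τ_z`, with `|z| ≤ K`" (PDF p. 6, after (1.13)):
`f_z` is multiplicative, CONSTANT (`= z`) on the primes — so (i)–(ii) hold for any admissible block
sequence, exactly as for the Liouville function — and `|z^{ω(n)}| ≤ 1 = τ_1(n)` when `|z| ≤ 1`, so
`f_z ∈ 𝓕(1, 1)` for every real `|z| ≤ 1`; at `D = 1` the generalised discrepancy `Δ_f(x; q, D, a)` of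
(1.15) is the plain one of (1.1) ((1.16), PDF p. 7), and `D^{C₀} = 1`.  Hence the def below is the
printed theorem instantiated at `D = 1`, `K = 1`, `f = f_z`, with the printed quantifier structure
("There exist `B = B(A, K)` and `C = C(A, K)` such that, uniformly for … `f ∈ 𝓕(D, K)`, `x ≥ 1`,
`Q ≤ √x/ℒ^B`") made explicit as `∃ B C, ∀ z, |z| ≤ 1 → ∀ x ≥ 1, …` — the constants do NOT depend
on `z` (uniformity in `f ∈ 𝓕(1, 1)` is part of the printed statement).  The sibling file
`FouvryTenenbaumLiouville.lean` vendors the same theorem for `f = λ`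
(`FouvryTenenbaum2021_thm18_liouville`); this file copies its rendering decisions verbatim.

Requested by / bears on: route `Summit.Parity.BatemanHorn.Theses.VanishingDimension` (planner's
"DEFINITION REQUESTS … Fouvry–Tenenbaum Thm 1.8 for τ_z / z^ω (the k = 1 linear instance of K1) as
Literature facts"); it is the nearest printed level-of-distribution statement for the tilted host
`w(n) = z^{ω(n)}` of the crux `…VanishingDimension.TiltedLevel` (stmt-Parity-18603) in the case
`k = 1`, `f = (X)`.  It does NOT ground that item: the crux concerns ROOT classes `r ≡ 0 (mod d)`
(multiples of `d`), a size law `(1 − log d/log x)^{z−1}` and a RELATIVE `ℓ¹` error `o(A₁V)` at level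
`x^θ`, whereas Theorem 1.8 compares COPRIME classes with `φ(q)⁻¹ ∑_{(n,q)=1} f(n)`, with absolute error
`x/ℒ^A` at level `x^{1/2}ℒ^{−B}` (see the grounding note on stmt-Parity-18603).

## Design / junk values (as in `FouvryTenenbaumLiouville.lean`)

* `omegaTiltAPDelta z x d a` is FT's `Δ_{f_z}(x; d, a)` of (1.1) for `f_z(n) = z^{ω(n)}`:
  `∑_{n ≤ x, n ≡ a (mod d)} z^{ω(n)} − φ(d)⁻¹ ∑_{n ≤ x, (n,d)=1} z^{ω(n)}`, `n` over `Icc 1 ⌊x⌋₊`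
  (`x < 1` gives `0`), congruence read in `ℤ` (`Int.ModEq d n a`), `φ(d)⁻¹ = 0` at `d = 0` (never
  used: `d = q ≥ 1`).  `0 ^ 0 = 1` in Lean matches `z^{ω(1)} = 1` at `z = 0` (then `f_0 = 𝟙_{n=1}`,
  also in `𝓕(1, 1)`).
* `ℒ = Real.log (3 * x) > 1` for `x ≥ 1`; `Q < 1` empties the `q`-sum and the conclusion
  `0 ≤ C x/ℒ^A` forces `C ≥ 0` (harmless, true in print).
* The printed `max_{(a, q) = 1}` is rendered by an arbitrary residue selector `a : ℕ → ℤ` with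
  `IsCoprime (a q) q` for every `q` (choose a maximiser per modulus).
-/

noncomputable section

open Finset

namespace Literature.NumberTheory.Sieve

/-- `Δ_{f_z}(x; d, a) = ∑_{n ≤ x, n ≡ a (mod d)} z^{ω(n)} − φ(d)⁻¹ ∑_{n ≤ x, (n, d) = 1} z^{ω(n)}` — the
discrepancy (1.1) of Fouvry–Tenenbaum for the tilt `f_z(n) = z^{ω(n)}`.
[cite: FouvryTenenbaum2021, (1.1)] -/
def omegaTiltAPDelta (z x : ℝ) (d : ℕ) (a : ℤ) : ℝ :=
  (∑ n ∈ (Icc 1 ⌊x⌋₊).filter (fun n : ℕ => Int.ModEq d n a),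
      z ^ (ArithmeticFunction.cardDistinctFactors n)) -
    ((Nat.totient d : ℝ))⁻¹ *
      ∑ n ∈ (Icc 1 ⌊x⌋₊).filter (fun n : ℕ => Nat.Coprime n d),
        z ^ (ArithmeticFunction.cardDistinctFactors n)

/-- NAMED FACT — **Fouvry–Tenenbaum 2021, Theorem 1.8, for `f = z^{ω}`, `|z| ≤ 1`** (PDF p. 9, §1.4:
"The following statement holds for suitable, absolute `C₀`. Let `A > 0`, `K > 0`. There exist
`B = B(A, K)` and `C = C(A, K)` such that, uniformly for `D ≥ 1`, `f ∈ 𝓕(D, K)`, `x ≥ 1`,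
`Q ≤ √x/ℒ^B`, we have `∑_{q ≤ Q} max_{(a, qD)=1} |Δ_f(x; q, D, a)| ≤ C D^{C₀} x/ℒ^A`", `ℒ = log 3x`),
instantiated at `D = 1`, `K = 1` and the members `f_z(n) = z^{ω(n)}`, `z ∈ [−1, 1]`, of `𝓕(1, 1)`
(PDF p. 6: "Typical examples of elements of `𝓕(1, K)` … are provided by the functions `n ↦ z^{ω(n)}`
and `τ_z`, with `|z| ≤ K`"); the constants `B, C` are uniform in `z` because the printed ones are
uniform in `f ∈ 𝓕(1, 1)`; the `max` over reduced residues is rendered by an arbitrary selector `a q`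
coprime to `q` (Bombieri–Vinogradov for `z^{ω}` at level `x^{1/2}ℒ^{−B}`).
Users take `(h : FouvryTenenbaum2021_thm18_omegaTilt)`; nearest print to (not a proof of) the `k = 1`
case of `Summit.Parity.BatemanHorn.Theses.VanishingDimension.TiltedLevel`.
[cite: FouvryTenenbaum2021, Thm 1.8 with Def. 1.1 and the example after (1.13)] -/
def FouvryTenenbaum2021_thm18_omegaTilt : Prop :=
  ∀ A : ℝ, 0 < A → ∃ B C : ℝ, ∀ z : ℝ, |z| ≤ 1 → ∀ x : ℝ, 1 ≤ x → ∀ Q : ℝ,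
    Q ≤ x ^ (1 / 2 : ℝ) / Real.log (3 * x) ^ B →
    ∀ a : ℕ → ℤ, (∀ q : ℕ, IsCoprime (a q) q) →
      ∑ q ∈ Icc 1 ⌊Q⌋₊, |omegaTiltAPDelta z x q (a q)| ≤ C * x / Real.log (3 * x) ^ A

/-- Sanity: modulo `d = 1` the discrepancy vanishes (both sums run over all `n ≤ x`, `φ(1) = 1`).
[folklore] -/
theorem omegaTiltAPDelta_one (z x : ℝ) (a : ℤ) : omegaTiltAPDelta z x 1 a = 0 := by
  unfold omegaTiltAPDelta
  have h1 : ((Icc 1 ⌊x⌋₊).filter fun n : ℕ => Int.ModEq ((1 : ℕ) : ℤ) n a) = Icc 1 ⌊x⌋₊ :=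
    Finset.filter_true_of_mem fun n _ => Int.modEq_one
  have h2 : ((Icc 1 ⌊x⌋₊).filter fun n : ℕ => Nat.Coprime n 1) = Icc 1 ⌊x⌋₊ :=
    Finset.filter_true_of_mem fun n _ => Nat.coprime_one_right n
  rw [h1, h2]
  simp

/-- Sanity: with an empty range of moduli (`Q < 1`) the left side of Theorem 1.8 vanishes. [folklore] -/
theorem FouvryTenenbaum2021_thm18_omegaTilt_lhs_of_lt_one (z x Q : ℝ) (hQ : Q < 1) (a : ℕ → ℤ) :
    ∑ q ∈ Icc 1 ⌊Q⌋₊, |omegaTiltAPDelta z x q (a q)| = 0 := by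
  have h : ⌊Q⌋₊ = 0 := Nat.floor_eq_zero.mpr hQ
  simp [h]

end Literature.NumberTheory.Sieve
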